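import Summits.QuantumFields.YangMills.Theorems.BalabanUVNodesN08TwoLevelInvisibleFiring

/-!
# BalabanUVNodes ∕ N08 — SEVERAL SIMULTANEOUS FIRINGS ARE INVISIBLE TWO LEVELS UP: the level-`k` step modified at a FINITE SET `S` of coarse bonds (each modification and the joint
# weight reading only the guards' read sets), the level-`k+1` step the straight transporter ⇒ the push-forward to level `k+2` is `(∫g)•Haar`, PROVIDED no level-`(k+2)` segment has
# BOTH its end blocks' centres touched by fired bonds (the same-level separation condition of the polymer expansion; automatic for one firing)

Track A, DAG node N08 ([Balaban1985UV3] Thm 1 p. 257 ∕ Thm 2 p. 272; averaging [Balaban1987RG1] (0.4) p. 253).  Cell `pub-ymgap`, seat `pub-ymgap-dag-n08-d` g47 (R529-ym job;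
DESIGN memo (M5) same-level core); `--supports stmt-QuantumFields-19936` (helper).  Finite-set twin of ✓`…N08TwoLevelInvisibleFiring` (one fired bond).

THE STATEMENT.  `S : Finset (PBond P (k+1))` fired bonds; values `m : PBond P (k+1) → (GaugeField P k G → G)`, `m c` measurable and reading only the loop words of `c` (`c ∈ S`); weight
`g ≥ 0` measurable, finite integral, invariant under every change of `U` off the union of the read sets; hybrid step `Hyb U c′ := if c′ ∈ S then m c′ U else axialAvg U c′`; level
`k+1 → k+2` by `axialAvg`.  SEPARATION: for every level-`(k+2)` segment `C`, EITHER no fired bond has the centre `emb C₊` as an endpoint OR no fired bond has `emb C₋` as an endpoint.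
THEN `((dU_k).withDensity g).map (axialAvg ∘ Hyb) = (∫⁻ g dU_k) • dU_{k+2}`.  (Two firings at BOTH end slots of one segment `C` are the excluded configuration: there the
block-level read sets leave no END fine bond of `C` free — such pairs are «adjacent» in the polymer expansion and form one cluster, handled one level higher.)

CONTENTS ([folklore]; 0 `def`, 0 `sorry`): `extend_last_apply_eq_one_of_read_mem` ∕ `extend_first_apply_eq_one_of_read_mem` (set versions of the one-bond lemmas), ★★★
`map_withDensity_axialAvg_piecewise_eq_smul`.
HONEST: count-neutral helper — same-level finite set, pure axial step above; clusters across levels ∕ KP not here; hTop ∕ (a)′∀ ∕ hJ NOT proved; N08 NOT discharged; R3 ≠ d = 4 ∕ mass gap ∕ Clay.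
-/

noncomputable section

open MeasureTheory
open scoped ENNReal

namespace Summit.QuantumFields.YangMills.Theorems.BalabanUVNodesN08TwoLevelInvisibleFirings

open Literature.MathematicalPhysics.QuantumFieldTheory.Balaban1983to89
open Literature.MathematicalPhysics.QuantumFieldTheory.Balaban1983to89.T4Continuum
open Literature.MathematicalPhysics.QuantumFieldTheory.Balaban1983to89.AveragingRT
open Literature.MathematicalPhysics.QuantumFieldTheory.Balaban1983to89.BlockAveraging
open Summit.QuantumFields.YangMills.Theorems.BalabanUVNodesN08AxialLaunderingFirstBond (first_injective axialAvg_mul_first)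
open Summit.QuantumFields.YangMills.Theorems.BalabanUVNodesN08LaunderingAbstract (map_withDensity_eq_smul_of_translations)
open Summit.QuantumFields.YangMills.Theorems.BalabanUVNodesN08TwoLevelInvisibleFiring (extend_last_apply_eq_one_of_read extend_first_apply_eq_one_of_read)

variable {P : Params} {k : ℕ} {G : Type*} [GaugeGroup G] [MeasurableSpace G] [HaarData G] [MeasurableMul₂ G] [MeasurableInv G]

/-- ★★★ **SEVERAL SIMULTANEOUS ISOLATED FIRINGS ARE INVISIBLE TWO LEVELS UP, under the same-level separation condition.** [cite: Balaban1987RG1, (0.4) p.253; Balaban1984PropagatorsI, (1.7) p.18] -/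
theorem map_withDensity_axialAvg_piecewise_eq_smul [DecidableEq (PBond P (k + 1))] (hk : k + 1 ≤ P.m + P.K) (hk1 : k + 1 + 1 ≤ P.m + P.K) (S : Finset (PBond P (k + 1)))
    {m : PBond P (k + 1) → GaugeField P k G → G} (hm : ∀ c ∈ S, Measurable (m c))
    (hm_read : ∀ c ∈ S, ∀ U U' : GaugeField P k G,
      (∀ (i : Idx P), ∀ s ∈ walk (emb c.src) (loopWord P.L c.dir (off i.1) i.2.1 i.2.2), U s.bond = U' s.bond) → m c U = m c U')
    {g : GaugeField P k G → ℝ≥0∞} (hg : Measurable g) (hgfin : ∫⁻ U, g U ∂(fieldMeasure P k G) ≠ ∞)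
    (hg_read : ∀ U U' : GaugeField P k G,
      (∀ c ∈ S, ∀ (i : Idx P), ∀ s ∈ walk (emb c.src) (loopWord P.L c.dir (off i.1) i.2.1 i.2.2), U s.bond = U' s.bond) → g U = g U')
    (hsep : ∀ C : PBond P (k + 1 + 1),
      (∀ c ∈ S, ¬ ((line C (P.L - 1)).tgt = c.src ∨ (line C (P.L - 1)).tgt = c.tgt)) ∨
      (∀ c ∈ S, ¬ ((line C 0).src = c.src ∨ (line C 0).src = c.tgt))) :
    ((fieldMeasure P k G).withDensity g).map
        (fun U : GaugeField P k G => (axialAvg (fun c' : PBond P (k + 1) => if c' ∈ S then m c' U else axialAvg U c') : GaugeField P (k + 1 + 1) G)) =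
      (∫⁻ U, g U ∂(fieldMeasure P k G)) • fieldMeasure P (k + 1 + 1) G := by
  -- incidence of a coarse bond's target ∕ source with SOME fired bond
  set IncT : PBond P (k + 1) → Prop := fun c₁ => ∃ c ∈ S, c₁.tgt = c.src ∨ c₁.tgt = c.tgt with hIncT
  set IncS : PBond P (k + 1) → Prop := fun c₁ => ∃ c ∈ S, c₁.src = c.src ∨ c₁.src = c.tgt with hIncS
  have hHyb : Measurable (fun U : GaugeField P k G => fun c' : PBond P (k + 1) => if c' ∈ S then m c' U else axialAvg U c') := by
    refine measurable_pi_iff.mpr fun c' => ?_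
    by_cases hc : c' ∈ S
    · simp only [hc, if_true]; exact hm c' hc
    · simp only [hc, if_false]; exact (measurable_pi_iff.mp measurable_axialAvg) c'
  have hΦ : Measurable (fun U : GaugeField P k G =>
      (axialAvg (fun c' : PBond P (k + 1) => if c' ∈ S then m c' U else axialAvg U c') : GaugeField P (k + 1 + 1) G)) :=
    measurable_axialAvg.comp hHyb
  refine map_withDensity_eq_smul_of_translations (G := G) (fieldMeasure P k G) {C : PBond P (k + 1 + 1) | ¬ IncT (line C (P.L - 1))} hg hgfin hΦ ?_ ?_
  · -- RIGHT translations on `T`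
    intro h hh
    set h' : GaugeField P (k + 1) G := Function.extend (fun C : PBond P (k + 1 + 1) => line C (P.L - 1)) h (fun _ => 1) with hh'
    -- `h'` is `1` at every coarse bond whose target is an endpoint of a fired bond
    have hh'1 : ∀ c ∈ S, ∀ c₁ : PBond P (k + 1), (c₁.tgt = c.src ∨ c₁.tgt = c.tgt) → h' c₁ = 1 := by
      intro c hcS c₁ hinc
      by_cases hex : ∃ C : PBond P (k + 1 + 1), line C (P.L - 1) = c₁
      · obtain ⟨C, rfl⟩ := hex
        rw [hh', (last_injective hk1).extend_apply]
        by_cases hC : C ∈ {C : PBond P (k + 1 + 1) | ¬ IncT (line C (P.L - 1))}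
        · exact absurd ⟨c, hcS, hinc⟩ hC
        · exact hh C hC
      · rw [hh', Function.extend_apply' _ _ _ hex]
    have hR_read : ∀ c ∈ S, ∀ (U : GaugeField P k G) (i : Idx P), ∀ s ∈ walk (emb c.src) (loopWord P.L c.dir (off i.1) i.2.1 i.2.2),
        U s.bond * Function.extend (fun c₁ : PBond P (k + 1) => line c₁ (P.L - 1)) h' (fun _ => 1) s.bond = U s.bond := by
      intro c hcS U i s hs
      rw [extend_last_apply_eq_one_of_read hk c h' (hh'1 c hcS) i s hs, mul_one]
    refine ⟨fun U b => U b * Function.extend (fun c₁ : PBond P (k + 1) => line c₁ (P.L - 1)) h' (fun _ => 1) b, measurePreserving_mulRight _, ?_, ?_⟩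
    · intro U; exact hg_read _ _ fun c hcS i s hs => hR_read c hcS U i s hs
    · intro U
      have hmU : ∀ c ∈ S, m c (fun b => U b * Function.extend (fun c₁ : PBond P (k + 1) => line c₁ (P.L - 1)) h' (fun _ => 1) b) = m c U :=
        fun c hcS => hm_read c hcS _ _ fun i s hs => hR_read c hcS U i s hs
      have hstep : (fun c' : PBond P (k + 1) => if c' ∈ S then m c' (fun b => U b * Function.extend (fun c₁ : PBond P (k + 1) => line c₁ (P.L - 1)) h' (fun _ => 1) b)
            else axialAvg (fun b => U b * Function.extend (fun c₁ : PBond P (k + 1) => line c₁ (P.L - 1)) h' (fun _ => 1) b) c')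
          = fun c' => (if c' ∈ S then m c' U else axialAvg U c') * Function.extend (fun C : PBond P (k + 1 + 1) => line C (P.L - 1)) h (fun _ => 1) c' := by
        funext c'
        rw [axialAvg_mul_last hk]
        by_cases hc : c' ∈ S
        · rw [if_pos hc, if_pos hc, hmU c' hc]
          show m c' U = m c' U * h' c'
          rw [hh'1 c' hc c' (Or.inr rfl), mul_one]
        · rw [if_neg hc, if_neg hc]
      show axialAvg _ = fun C => axialAvg (fun c' : PBond P (k + 1) => if c' ∈ S then m c' U else axialAvg U c') C * h C
      rw [hstep, axialAvg_mul_last hk1]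
  · -- LEFT translations off `T`: there NO fired bond touches the source of the first slot
    intro h hh
    set h' : GaugeField P (k + 1) G := Function.extend (fun C : PBond P (k + 1 + 1) => line C 0) h (fun _ => 1) with hh'
    have hh'1 : ∀ c ∈ S, ∀ c₁ : PBond P (k + 1), (c₁.src = c.src ∨ c₁.src = c.tgt) → h' c₁ = 1 := by
      intro c hcS c₁ hinc
      by_cases hex : ∃ C : PBond P (k + 1 + 1), line C 0 = c₁
      · obtain ⟨C, rfl⟩ := hex
        rw [hh', (first_injective hk1).extend_apply]
        by_cases hC : C ∈ {C : PBond P (k + 1 + 1) | ¬ IncT (line C (P.L - 1))}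
        · exact hh C hC
        · rcases hsep C with h1 | h1
          · exact absurd (fun ⟨c₂, hc₂, hi⟩ => h1 c₂ hc₂ hi) hC
          · exact absurd hinc (h1 c hcS)
      · rw [hh', Function.extend_apply' _ _ _ hex]
    have hL_read : ∀ c ∈ S, ∀ (U : GaugeField P k G) (i : Idx P), ∀ s ∈ walk (emb c.src) (loopWord P.L c.dir (off i.1) i.2.1 i.2.2),
        Function.extend (fun c₁ : PBond P (k + 1) => line c₁ 0) h' (fun _ => 1) s.bond * U s.bond = U s.bond := by
      intro c hcS U i s hs
      rw [extend_first_apply_eq_one_of_read hk c h' (hh'1 c hcS) i s hs, one_mul]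
    refine ⟨fun U b => Function.extend (fun c₁ : PBond P (k + 1) => line c₁ 0) h' (fun _ => 1) b * U b, measurePreserving_mulLeft _, ?_, ?_⟩
    · intro U; exact hg_read _ _ fun c hcS i s hs => hL_read c hcS U i s hs
    · intro U
      have hmU : ∀ c ∈ S, m c (fun b => Function.extend (fun c₁ : PBond P (k + 1) => line c₁ 0) h' (fun _ => 1) b * U b) = m c U :=
        fun c hcS => hm_read c hcS _ _ fun i s hs => hL_read c hcS U i s hs
      have hstep : (fun c' : PBond P (k + 1) => if c' ∈ S then m c' (fun b => Function.extend (fun c₁ : PBond P (k + 1) => line c₁ 0) h' (fun _ => 1) b * U b)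
            else axialAvg (fun b => Function.extend (fun c₁ : PBond P (k + 1) => line c₁ 0) h' (fun _ => 1) b * U b) c')
          = fun c' => Function.extend (fun C : PBond P (k + 1 + 1) => line C 0) h (fun _ => 1) c' * (if c' ∈ S then m c' U else axialAvg U c') := by
        funext c'
        rw [axialAvg_mul_first hk]
        by_cases hc : c' ∈ S
        · rw [if_pos hc, if_pos hc, hmU c' hc]
          show m c' U = h' c' * m c' U
          rw [hh'1 c' hc c' (Or.inl rfl), one_mul]
        · rw [if_neg hc, if_neg hc]
      show axialAvg _ = fun C => h C * axialAvg (fun c' : PBond P (k + 1) => if c' ∈ S then m c' U else axialAvg U c') C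
      rw [hstep, axialAvg_mul_first hk1]

/-- ★ **For ONE fired bond the separation condition is the torus fact of `…N08TwoLevelInvisibleFiring.last_tgt_or_first_src_off`** — the finite-set theorem contains the single-firing one
(consistency check of the letters; the displayed `hsep` is what the same-level polymer combinatorics (M5) supplies for separated sets). [folklore] -/
theorem hsep_singleton [DecidableEq (PBond P (k + 1))] (hk1 : k + 1 + 1 ≤ P.m + P.K) (c : PBond P (k + 1)) (C : PBond P (k + 1 + 1)) :
    (∀ c' ∈ ({c} : Finset (PBond P (k + 1))), ¬ ((line C (P.L - 1)).tgt = c'.src ∨ (line C (P.L - 1)).tgt = c'.tgt)) ∨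
      (∀ c' ∈ ({c} : Finset (PBond P (k + 1))), ¬ ((line C 0).src = c'.src ∨ (line C 0).src = c'.tgt)) := by
  rcases BalabanUVNodesN08TwoLevelInvisibleFiring.last_tgt_or_first_src_off hk1 c C with h | h
  · exact Or.inl fun c' hc' => by rw [Finset.mem_singleton] at hc'; subst hc'; exact h
  · exact Or.inr fun c' hc' => by rw [Finset.mem_singleton] at hc'; subst hc'; exact h

end Summit.QuantumFields.YangMills.Theorems.BalabanUVNodesN08TwoLevelInvisibleFirings

end
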